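import Summits.BirchSwinnertonDyer.BirchSwinnertonDyer.Theorems.UniversalToricDescentResidualRelaxedComap
import Summits.BirchSwinnertonDyer.BirchSwinnertonDyer.Theorems.UniversalToricDescentLocalKummerKernel
import Literature.NumberTheory.EllipticCurves.DiscreteH1Equiv
import Literature.NumberTheory.EllipticCurves.WeilPairingTateDual
import Summits.BirchSwinnertonDyer.BirchSwinnertonDyer.Theorems.UniversalToricDescentResidualCountLemmas
import HarnessLib

/-!
# Route UniversalToricDescent — the EXACT residual comparison WITHOUT (L):
# `#Sel_𝔭^Σ(K_∞, E₁[p^∞])[p] = #Sel_𝔭^Σ(K_∞, E₂[p^∞])[p]` for `E₁[p] ≅ E₂[p]`, from base finiteness of BOTH curves at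
# the conjugate prime and finiteness of their local tower torsion at the strict place

Lead prover bsd-wall-utd-p1 g13 (`--supports` ♭T′ stmt-BirchSwinnertonDyer-26975; step (γb2b) — the COUNT — of the (L)-free
residual comparison (M1) of stub B′ `stub_lambdaTransportPT`, memo RESIDUE-B-PRIME-utdp1g13 §3). The tree's
`natCard_selmerAc_pTorsion_eq_of_torsionIso` needs (L) `E₁[p]^{H ∩ D_𝔭} = 0`; here (L) is replaced by Greenberg–Vatsal
Prop. 2.1 at the strict place for BOTH curves (`…StrictPlaceSurjectiveAnyTorsion`: Poitou–Tate, `H²(K, E_i[p^∞]) = 0`,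
`Sel_𝔮(K, E_i[p^∞]) < ∞`), the `p`-divisibility of `Sel_𝔭^Σ(K_∞, E_i[p^∞])` (route: `selmerAc_divisible_of_finite_pTorsion_anyTorsion`)
and the finiteness of the local tower torsion `E_i(K_{∞,𝔭})[p^∞]` for both (the local Kummer kernels then have the common
order `#E[p]^{H ∩ D_𝔭}`, `…LocalKummerKernel`). §1: two counting lemmas (`#Ψ⁻¹(T) = #ker Ψ · #(Ψ(U) ∩ T)`; `#T = #(P/Ψ(U)) ·
#(Ψ(U) ∩ T)` when `Ψ(U) + T = P`). §2: **`natCard_selmerAc_pTorsion_eq_of_torsionIso_noL`** with `U = H¹_ur(K_Σ/K_∞, E_i[p])`,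
`Ψ` the residual tuple signature at `𝔭` (kernel = strict residual Selmer group), `T_i = (ker ι_G)^{p^c}`,
`Ψ⁻¹(T_i) = ι_i⁻¹(Sel(E_i))`; `U`, `Ψ`, `P/Ψ(U)` are transported along `E₁[p] ≅ E₂[p]` and `#T₁ = #T₂`.
HONEST STATUS: helper theorems, CONDITIONAL on the cited Poitou–Tate facts; the twin's base finiteness and local tower torsion
finiteness are HYPOTHESES. THEOREMS ONLY; no definition, no named fact, no `sorry`. BSD is not advanced by this file.
References: [GreenbergVatsal2000] §2 Prop. (2.1), (2.8) (pp. 23–27); [GreenbergLNM1716] §3, §5 p. 114; [SerreGaloisCohomology1997] I §2.4.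
-/

set_option autoImplicit false
-- `…BirchSwinnertonDyer.BirchSwinnertonDyer.Theorems…` is the problem's mandated namespace (D-0017).
set_option linter.dupNamespace false

noncomputable section
open scoped Classical

namespace Summit.BirchSwinnertonDyer.BirchSwinnertonDyer.Theorems.UniversalToricDescentStrictPlaceTuple

open CategoryTheory Function Field NumberField IsDedekindDomain WeierstrassCurve
open Literature.NumberTheory.GaloisRepresentations Literature.NumberTheory.EllipticCurves
  Literature.NumberTheory.EllipticCurves.GreenbergSelmer Literature.NumberTheory.EllipticCurves.GreenbergVatsal2000
  Literature.NumberTheory.GaloisCohomology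
  Summit.BirchSwinnertonDyer.Rank1Residual Summit.BirchSwinnertonDyer.Rank1Residual.X11b
  Summit.BirchSwinnertonDyer.Rank1Residual.X11b.Coinv Summit.BirchSwinnertonDyer.Rank1Residual.X11b.LocBridge
  Summit.BirchSwinnertonDyer.Rank1Residual.X11b.AcSelmer
  Summit.BirchSwinnertonDyer.BirchSwinnertonDyer.Theorems.UniversalToricDescentSigmaLocalStabilizer
  Summit.BirchSwinnertonDyer.BirchSwinnertonDyer.Theorems.UniversalToricDescentSigmaLocalImage
  Summit.BirchSwinnertonDyer.BirchSwinnertonDyer.Theorems.UniversalToricDescentResidualSelmer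
  Summit.BirchSwinnertonDyer.BirchSwinnertonDyer.Theorems.UniversalToricDescentResidualSelmerExact
  Summit.BirchSwinnertonDyer.BirchSwinnertonDyer.Theorems.UniversalToricDescentLocalKummer

/-! ### §2 The (L)-free exact residual comparison -/
variable {K : Type} [Field K] [NumberField K] {p : ℕ} [Fact p.Prime] (κ : ZpExtension K p)

set_option maxHeartbeats 800000 in
/-- **`#Sel_𝔭^Σ(K_∞, E₁[p^∞])[p] = #Sel_𝔭^Σ(K_∞, E₂[p^∞])[p]` WITHOUT (L)**, for elliptic curves over a totally complex `K`
with a `Γ_K`-equivariant `E₁[p] ≅ E₂[p]`, any `ℤ_p`-extension, primes `𝔭 ≠ 𝔮` above `p` (`𝔭` finitely decomposed, exact index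
`p^c`), `Σ ⊇` the bad places prime to `p`, a fake strict place `v₀ ∤ p` outside `Σ`; GIVEN Poitou–Tate, Milne I 2.8, killing
exponents, FINITE `Sel_𝔮(K, E_i[p^∞])`, `H²(K, E_i[p^∞]) = 0`, `E₁(K_∞)[p] = 0`, `p`-divisibility of `Sel_𝔭^Σ(K_∞, E_i[p^∞])`
and FINITE `E_i[p^∞]^{H ∩ D_𝔭}` for BOTH curves. [cite: GreenbergVatsal2000, §2 Prop. (2.1), (2.8) (pp. 23–27)]
[cite: GreenbergLNM1716, §3, §5 p. 114] -/
theorem natCard_selmerAc_pTorsion_eq_of_torsionIso_noL [IsTotallyComplex K] (W₁ W₂ : WeierstrassCurve K)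
    [W₁.IsElliptic] [W₂.IsElliptic]
    (hPT : poitouTate_selmerStructure_duality K)
    (hEP : ∀ v : HeightOneSpectrum (𝓞 K), localEulerPoincareCharacteristic (v.adicCompletion K))
    {𝔭 𝔮 : HeightOneSpectrum (𝓞 K)} (h𝔭 : ((p : ℕ) : 𝓞 K) ∈ 𝔭.asIdeal)
    (h𝔮 : ((p : ℕ) : 𝓞 K) ∈ 𝔮.asIdeal) (hne : 𝔮 ≠ 𝔭)
    {m₁ : ℕ} (htor₁ : ∀ Q : W₁.geomPrimaryTorsion p, (∀ d ∈ decomp 𝔮, d • Q = Q) → p ^ m₁ • Q = 0)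
    {m₂ : ℕ} (htor₂ : ∀ Q : W₂.geomPrimaryTorsion p, (∀ d ∈ decomp 𝔮, d • Q = Q) → p ^ m₂ • Q = 0)
    (hfin₁ : Finite (selmerAcBase W₁ p 𝔮 ∅)) (hfin₂ : Finite (selmerAcBase W₂ p 𝔮 ∅))
    (h2₁ : Subsingleton (galoisCohomology (primaryGaloisModule W₁ p) 2))
    (h2₂ : Subsingleton (galoisCohomology (primaryGaloisModule W₂ p) 2))
    {γ : absoluteGaloisGroup K} (hγ : κ.IsTopGenerator γ) {S : Set (HeightOneSpectrum (𝓞 K))}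
    (hS₁ : ∀ v : HeightOneSpectrum (𝓞 K), v ∉ S → ((p : ℕ) : 𝓞 K) ∉ v.asIdeal → W₁.HasGoodReductionAt v)
    (hS₂ : ∀ v : HeightOneSpectrum (𝓞 K), v ∉ S → ((p : ℕ) : 𝓞 K) ∉ v.asIdeal → W₂.HasGoodReductionAt v)
    {v₀ : HeightOneSpectrum (𝓞 K)} (hv₀ : ((p : ℕ) : 𝓞 K) ∉ v₀.asIdeal) (hv₀S : v₀ ∉ S) {c : ℕ}
    (hc : ∀ z : ℤ_[p], ∃ d : decomp (K := K) 𝔭, (κ (d : absoluteGaloisGroup K)).toAdd = (p : ℤ_[p]) ^ c * z)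
    (hle : ∀ d : decomp (K := K) 𝔭, (p : ℤ_[p]) ^ c ∣ (κ (d : absoluteGaloisGroup K)).toAdd)
    (e : W₁.geomTorsion (p : ℤ) ≃+ W₂.geomTorsion (p : ℤ))
    (he : ∀ (σ : absoluteGaloisGroup K) (P : W₁.geomTorsion (p : ℤ)), e (σ • P) = σ • e P)
    (hG₁ : ∀ m : W₁.geomPrimaryTorsion p, (∀ σ ∈ κ.kerSubgroup, σ • m = m) → p • m = 0 → m = 0)
    (hdiv₁ : ∀ s ∈ selmerAc W₁ p κ 𝔭 S, ∃ s' ∈ selmerAc W₁ p κ 𝔭 S, p • s' = s)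
    (hfinS₁ : Set.Finite {s : selmerAc W₁ p κ 𝔭 S | p • s = 0})
    (hdiv₂ : Set.Finite {s : selmerAc W₂ p κ 𝔭 S | p • s = 0} →
      ∀ s ∈ selmerAc W₂ p κ 𝔭 S, ∃ s' ∈ selmerAc W₂ p κ 𝔭 S, p • s' = s)
    (hδ₁ : (FixedPoints.addSubgroup (kerD κ 𝔭) (W₁.geomPrimaryTorsion p) : Set (W₁.geomPrimaryTorsion p)).Finite)
    (hδ₂ : (FixedPoints.addSubgroup (kerD κ 𝔭) (W₂.geomPrimaryTorsion p) : Set (W₂.geomPrimaryTorsion p)).Finite) :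
    Nat.card {s : selmerAc W₁ p κ 𝔭 S // p • s = 0} = Nat.card {s : selmerAc W₂ p κ 𝔭 S // p • s = 0} := by
  have hG₂ : ∀ m : W₂.geomPrimaryTorsion p, (∀ σ ∈ κ.kerSubgroup, σ • m = m) → p • m = 0 → m = 0 :=
    noFixedPTorsion_of_torsionIso W₁ W₂ κ.kerSubgroup e he hG₁
  -- notation: `M_i = E_i[p]`, `U_i = H¹_ur`, `P_i = H¹(G, M_i)^{p^c}`, `Ψ_i`, `ιG_i`, `T_i = (ker ιG_i)^{p^c}`
  let M₁ := W₁.geomTorsion (p : ℤ)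
  let M₂ := W₂.geomTorsion (p : ℤ)
  let U₁ : AddSubgroup (Literature.NumberTheory.EllipticCurves.subgroupH1 κ.kerSubgroup M₁) := unramifiedOutside κ.kerSubgroup M₁ p S
  let U₂ : AddSubgroup (Literature.NumberTheory.EllipticCurves.subgroupH1 κ.kerSubgroup M₂) := unramifiedOutside κ.kerSubgroup M₂ p S
  let Ψ₁ : U₁ →+ (Fin (p ^ c) → Literature.NumberTheory.EllipticCurves.subgroupH1 (kerD κ 𝔭) M₁) :=
    { toFun := fun u k ↦ resKerD κ M₁ 𝔭 (Literature.NumberTheory.EllipticCurves.conjH1 κ.kerSubgroup M₁ (γ ^ (k : ℕ)) u)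
      map_zero' := funext fun k ↦ by simp
      map_add' := fun a b ↦ funext fun k ↦ by simp }
  let Ψ₂ : U₂ →+ (Fin (p ^ c) → Literature.NumberTheory.EllipticCurves.subgroupH1 (kerD κ 𝔭) M₂) :=
    { toFun := fun u k ↦ resKerD κ M₂ 𝔭 (Literature.NumberTheory.EllipticCurves.conjH1 κ.kerSubgroup M₂ (γ ^ (k : ℕ)) u)
      map_zero' := funext fun k ↦ by simp
      map_add' := fun a b ↦ funext fun k ↦ by simp }
  have hΨ₁ : ∀ (u : U₁) (k : Fin (p ^ c)), Ψ₁ u k =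
      resKerD κ M₁ 𝔭 (Literature.NumberTheory.EllipticCurves.conjH1 κ.kerSubgroup M₁ (γ ^ (k : ℕ)) u) := fun _ _ ↦ rfl
  have hΨ₂ : ∀ (u : U₂) (k : Fin (p ^ c)), Ψ₂ u k =
      resKerD κ M₂ 𝔭 (Literature.NumberTheory.EllipticCurves.conjH1 κ.kerSubgroup M₂ (γ ^ (k : ℕ)) u) := fun _ _ ↦ rfl
  let ιG₁ : Literature.NumberTheory.EllipticCurves.subgroupH1 (kerD κ 𝔭) M₁ →+
      Literature.NumberTheory.EllipticCurves.subgroupH1 (kerD κ 𝔭) (W₁.geomPrimaryTorsion p) :=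
    resH1Hom (ContinuousMonoidHom.id (kerD κ 𝔭)) (AddSubgroup.inclusion (geomTorsion_le_geomPrimaryTorsion W₁ p))
      (fun _ _ ↦ rfl)
  let ιG₂ : Literature.NumberTheory.EllipticCurves.subgroupH1 (kerD κ 𝔭) M₂ →+
      Literature.NumberTheory.EllipticCurves.subgroupH1 (kerD κ 𝔭) (W₂.geomPrimaryTorsion p) :=
    resH1Hom (ContinuousMonoidHom.id (kerD κ 𝔭)) (AddSubgroup.inclusion (geomTorsion_le_geomPrimaryTorsion W₂ p))
      (fun _ _ ↦ rfl)
  let T₁ : AddSubgroup (Fin (p ^ c) → Literature.NumberTheory.EllipticCurves.subgroupH1 (kerD κ 𝔭) M₁) :=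
    (ιG₁.compLeft (Fin (p ^ c))).ker
  let T₂ : AddSubgroup (Fin (p ^ c) → Literature.NumberTheory.EllipticCurves.subgroupH1 (kerD κ 𝔭) M₂) :=
    (ιG₂.compLeft (Fin (p ^ c))).ker
  have hT₁ : ∀ f, f ∈ T₁ ↔ ∀ k, ιG₁ (f k) = 0 := fun f ↦ by
    rw [AddMonoidHom.mem_ker]; exact funext_iff
  have hT₂ : ∀ f, f ∈ T₂ ↔ ∀ k, ιG₂ (f k) = 0 := fun f ↦ by
    rw [AddMonoidHom.mem_ker]; exact funext_iff
  -- (1) `#Ψ_i⁻¹(T_i) = #Sel(E_i)[p]`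
  have hcomap₁ : Nat.card (T₁.comap Ψ₁) = Nat.card {s : selmerAc W₁ p κ 𝔭 S // p • s = 0} := by
    rw [← UniversalToricDescentResidualSelmerExact.natCard_comap_torsionToPrimaryH1Sub_selmerAc_eq W₁ κ hG₁ 𝔭 S]
    refine Nat.card_congr (Equiv.ofBijective (fun u ↦ (⟨u.1.1, ?_⟩ :
      (selmerAc W₁ p κ 𝔭 S).comap (W₁.torsionToPrimaryH1Sub p κ.kerSubgroup))) ⟨fun a b h ↦ ?_, fun y ↦ ?_⟩)
    · rw [AddSubgroup.mem_comap,
        mem_comap_selmerAc_iff_forall_fin_iota_resKerD_eq_zero W₁ p κ hγ hc hS₁ hv₀ hv₀S u.1.2]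
      have hu := (hT₁ _).mp ((AddSubgroup.mem_comap).mp u.2)
      exact fun i ↦ hu i
    · have h' := Subtype.ext_iff.mp h
      exact Subtype.ext (Subtype.ext h')
    · have hyU : y.1 ∈ U₁ := by
        have h : y.1 ∈ (selmerAc W₁ p κ v₀ S).comap (W₁.torsionToPrimaryH1Sub p κ.kerSubgroup) := by
          rw [AddSubgroup.mem_comap]
          exact selmerAc_le_relaxed W₁ p κ 𝔭 hv₀ hv₀S ((AddSubgroup.mem_comap).mp y.2)
        rwa [comap_torsionToPrimaryH1Sub_relaxed_eq_unramifiedOutside W₁ p κ hS₁ hv₀ hv₀S] at h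
      have hyT : (⟨y.1, hyU⟩ : U₁) ∈ T₁.comap Ψ₁ := by
        rw [AddSubgroup.mem_comap, hT₁]
        exact (mem_comap_selmerAc_iff_forall_fin_iota_resKerD_eq_zero W₁ p κ hγ hc hS₁ hv₀ hv₀S hyU).mp
          ((AddSubgroup.mem_comap).mp y.2)
      exact ⟨⟨_, hyT⟩, rfl⟩
  have hcomap₂ : Nat.card (T₂.comap Ψ₂) = Nat.card {s : selmerAc W₂ p κ 𝔭 S // p • s = 0} := by
    rw [← UniversalToricDescentResidualSelmerExact.natCard_comap_torsionToPrimaryH1Sub_selmerAc_eq W₂ κ hG₂ 𝔭 S]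
    refine Nat.card_congr (Equiv.ofBijective (fun u ↦ (⟨u.1.1, ?_⟩ :
      (selmerAc W₂ p κ 𝔭 S).comap (W₂.torsionToPrimaryH1Sub p κ.kerSubgroup))) ⟨fun a b h ↦ ?_, fun y ↦ ?_⟩)
    · rw [AddSubgroup.mem_comap,
        mem_comap_selmerAc_iff_forall_fin_iota_resKerD_eq_zero W₂ p κ hγ hc hS₂ hv₀ hv₀S u.1.2]
      have hu := (hT₂ _).mp ((AddSubgroup.mem_comap).mp u.2)
      exact fun i ↦ hu i
    · have h' := Subtype.ext_iff.mp h
      exact Subtype.ext (Subtype.ext h')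
    · have hyU : y.1 ∈ U₂ := by
        have h : y.1 ∈ (selmerAc W₂ p κ v₀ S).comap (W₂.torsionToPrimaryH1Sub p κ.kerSubgroup) := by
          rw [AddSubgroup.mem_comap]
          exact selmerAc_le_relaxed W₂ p κ 𝔭 hv₀ hv₀S ((AddSubgroup.mem_comap).mp y.2)
        rwa [comap_torsionToPrimaryH1Sub_relaxed_eq_unramifiedOutside W₂ p κ hS₂ hv₀ hv₀S] at h
      have hyT : (⟨y.1, hyU⟩ : U₂) ∈ T₂.comap Ψ₂ := by
        rw [AddSubgroup.mem_comap, hT₂]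
        exact (mem_comap_selmerAc_iff_forall_fin_iota_resKerD_eq_zero W₂ p κ hγ hc hS₂ hv₀ hv₀S hyU).mp
          ((AddSubgroup.mem_comap).mp y.2)
      exact ⟨⟨_, hyT⟩, rfl⟩
  -- (2) `#ker Ψ₁ = #ker Ψ₂` (both = the strict residual Selmer group, `E[p]`-intrinsic)
  have hkerΨ : ∀ (W : WeierstrassCurve K) [W.IsElliptic]
      (Ψ : unramifiedOutside κ.kerSubgroup (W.geomTorsion (p : ℤ)) p S →+
        (Fin (p ^ c) → Literature.NumberTheory.EllipticCurves.subgroupH1 (kerD κ 𝔭) (W.geomTorsion (p : ℤ)))),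
      (∀ (u : unramifiedOutside κ.kerSubgroup (W.geomTorsion (p : ℤ)) p S) (k : Fin (p ^ c)), Ψ u k =
        resKerD κ (W.geomTorsion (p : ℤ)) 𝔭
          (Literature.NumberTheory.EllipticCurves.conjH1 κ.kerSubgroup (W.geomTorsion (p : ℤ)) (γ ^ (k : ℕ)) u)) →
      Nat.card Ψ.ker = Nat.card (datumStrictSelmer κ.kerSubgroup (W.geomTorsion (p : ℤ)) p
        (AcSelmer.bdpData _ p 𝔭) S) := by
    intro W _ Ψ hΨ
    refine Nat.card_congr (Equiv.ofBijective (fun u ↦ (⟨u.1.1,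
      ?_⟩ : datumStrictSelmer κ.kerSubgroup (W.geomTorsion (p : ℤ)) p (AcSelmer.bdpData _ p 𝔭) S)) ⟨fun a b h ↦ ?_, fun y ↦ ?_⟩)
    · rw [← forall_fin_resKerD_conjH1_eq_zero_iff_mem_datumStrictSelmer W p κ hγ h𝔭 hc u.1.2]
      intro i
      have h := congrFun ((AddMonoidHom.mem_ker).mp u.2) i
      rw [hΨ] at h
      exact h
    · have h' := Subtype.ext_iff.mp h
      exact Subtype.ext (Subtype.ext h')
    · have hyU : y.1 ∈ unramifiedOutside κ.kerSubgroup (W.geomTorsion (p : ℤ)) p S := ((mem_datumStrictSelmer_iff _).mp y.2).1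
      have hy0 := (forall_fin_resKerD_conjH1_eq_zero_iff_mem_datumStrictSelmer W p κ hγ h𝔭 hc hyU).mpr y.2
      have hyK : (⟨y.1, hyU⟩ : unramifiedOutside κ.kerSubgroup (W.geomTorsion (p : ℤ)) p S) ∈ Ψ.ker := by
        rw [AddMonoidHom.mem_ker]
        funext i
        rw [hΨ]
        exact hy0 i
      exact ⟨⟨_, hyK⟩, rfl⟩
  have hker : Nat.card Ψ₁.ker = Nat.card Ψ₂.ker := by
    rw [hkerΨ W₁ Ψ₁ hΨ₁, hkerΨ W₂ Ψ₂ hΨ₂]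
    exact UniversalToricDescentResidualSelmerExact.natCard_residualSelmer_eq_of_addEquiv κ.kerSubgroup p 𝔭 S e he
  -- (3) `#T₁ = #T₂` (local Kummer kernels) and finiteness
  have hTcard : ∀ (W : WeierstrassCurve K) [W.IsElliptic],
      (FixedPoints.addSubgroup (kerD κ 𝔭) (W.geomPrimaryTorsion p) : Set (W.geomPrimaryTorsion p)).Finite →
      Nat.card ((resH1Hom (ContinuousMonoidHom.id (kerD κ 𝔭))
        (AddSubgroup.inclusion (geomTorsion_le_geomPrimaryTorsion W p)) (fun _ _ ↦ rfl) :
          Literature.NumberTheory.EllipticCurves.subgroupH1 (kerD κ 𝔭) (W.geomTorsion (p : ℤ)) →+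
            Literature.NumberTheory.EllipticCurves.subgroupH1 (kerD κ 𝔭) (W.geomPrimaryTorsion p)).compLeft
              (Fin (p ^ c))).ker =
        Nat.card (FixedPoints.addSubgroup (kerD κ 𝔭) (W.geomTorsion (p : ℤ))) ^ (p ^ c) := by
    intro W _ hδ
    rw [← natCard_ker_kummer_eq_natCard_fixed_torsion W p (kerD κ 𝔭) hδ, ← Nat.card_fin (p ^ c), ← Nat.card_fun,
      Nat.card_fin]
    refine Nat.card_congr
      { toFun := fun f i ↦ ⟨f.1 i, (congrFun ((AddMonoidHom.mem_ker).mp f.2) i :)⟩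
        invFun := fun g ↦ ⟨fun i ↦ (g i).1, (AddMonoidHom.mem_ker).mpr (funext fun i ↦ (g i).2)⟩
        left_inv := fun f ↦ rfl
        right_inv := fun g ↦ rfl }
  have hTeq : Nat.card T₁ = Nat.card T₂ := by
    change Nat.card (ιG₁.compLeft (Fin (p ^ c))).ker = Nat.card (ιG₂.compLeft (Fin (p ^ c))).ker
    rw [hTcard W₁ hδ₁, hTcard W₂ hδ₂, natCard_fixed_torsion_eq_of_torsionIso p (kerD κ 𝔭) W₁ W₂ e he]
  have hTpos : Nat.card T₁ ≠ 0 := by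
    change Nat.card (ιG₁.compLeft (Fin (p ^ c))).ker ≠ 0
    rw [hTcard W₁ hδ₁]
    haveI : NeZero p := ⟨(Fact.out : p.Prime).ne_zero⟩
    haveI : Finite (W₁.geomTorsion (p : ℤ)) := by
      have h := finite_geomTorsion_of_neZero W₁ p
      exact h
    haveI : Finite (FixedPoints.addSubgroup (kerD κ 𝔭) (W₁.geomTorsion (p : ℤ))) :=
      Finite.of_injective (fun x ↦ (x : W₁.geomTorsion (p : ℤ))) Subtype.val_injective
    exact pow_ne_zero _ Nat.card_pos.ne'
  -- (4) `Ψ_i(U_i) + T_i = P_i` (strict-place surjectivity + divisibility + Kummer lift)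
  have hsup₁ : ∀ f, ∃ u : U₁, f - Ψ₁ u ∈ T₁ := by
    intro f
    obtain ⟨u, hu, huf⟩ := exists_comap_forall_fin_iota_resKerD_eq W₁ p κ hPT hEP h𝔭 h𝔮 hne htor₁ hfin₁ h2₁ hγ S
      hv₀ hv₀S hc hle hdiv₁ f
    have huU : u ∈ U₁ := by
      rwa [comap_torsionToPrimaryH1Sub_relaxed_eq_unramifiedOutside W₁ p κ hS₁ hv₀ hv₀S] at hu
    refine ⟨⟨u, huU⟩, (hT₁ _).mpr fun k ↦ ?_⟩
    rw [Pi.sub_apply, map_sub, hΨ₁, sub_eq_zero]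
    exact (huf k).symm
  -- finiteness of `Sel(E₂)[p]` (from `#Ψ₂⁻¹(T₂) = #ker Ψ₂ · #(Ψ₂(U₂) ∩ T₂)`, both factors finite and non-zero)
  have hne₁ : Nat.card {s : selmerAc W₁ p κ 𝔭 S // p • s = 0} ≠ 0 := by
    haveI : Finite {s : selmerAc W₁ p κ 𝔭 S // p • s = 0} := hfinS₁.to_subtype
    haveI : Nonempty {s : selmerAc W₁ p κ 𝔭 S // p • s = 0} := ⟨⟨0, smul_zero p⟩⟩
    exact Nat.card_pos.ne'
  have hkerfin : Nat.card Ψ₂.ker ≠ 0 := by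
    rw [← hker]
    haveI : Finite (T₁.comap Ψ₁) := Nat.finite_of_card_ne_zero (by rw [hcomap₁]; exact hne₁)
    haveI : Finite Ψ₁.ker := by
      refine Finite.of_injective (fun u ↦ (⟨(u : U₁), ?_⟩ : T₁.comap Ψ₁)) fun a b h ↦ ?_
      · rw [AddSubgroup.mem_comap, (AddMonoidHom.mem_ker).mp u.2]; exact T₁.zero_mem
      · have h' := Subtype.ext_iff.mp h
        exact Subtype.ext h'
    exact Nat.card_pos.ne'
  have hTpos₂ : Nat.card T₂ ≠ 0 := hTeq ▸ hTpos
  have hfinS₂ : Set.Finite {s : selmerAc W₂ p κ 𝔭 S | p • s = 0} := by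
    have hA := natCard_comap_eq_natCard_ker_mul Ψ₂ T₂
    haveI : Finite T₂ := Nat.finite_of_card_ne_zero hTpos₂
    have hI : Nat.card ((Ψ₂.range).addSubgroupOf T₂) ≠ 0 := Nat.card_pos.ne'
    have hc : Nat.card (T₂.comap Ψ₂) ≠ 0 := by rw [hA]; exact mul_ne_zero hkerfin hI
    rw [hcomap₂] at hc
    haveI := Nat.finite_of_card_ne_zero hc
    exact Set.finite_coe_iff.mp (by assumption)
  replace hdiv₂ := hdiv₂ hfinS₂
  have hsup₂ : ∀ f, ∃ u : U₂, f - Ψ₂ u ∈ T₂ := by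
    intro f
    obtain ⟨u, hu, huf⟩ := exists_comap_forall_fin_iota_resKerD_eq W₂ p κ hPT hEP h𝔭 h𝔮 hne htor₂ hfin₂ h2₂ hγ S
      hv₀ hv₀S hc hle hdiv₂ f
    have huU : u ∈ U₂ := by
      rwa [comap_torsionToPrimaryH1Sub_relaxed_eq_unramifiedOutside W₂ p κ hS₂ hv₀ hv₀S] at hu
    refine ⟨⟨u, huU⟩, (hT₂ _).mpr fun k ↦ ?_⟩
    rw [Pi.sub_apply, map_sub, hΨ₂, sub_eq_zero]
    exact (huf k).symm
  -- (5) the index `#(P_i / Ψ_i(U_i))` is `E[p]`-intrinsic: transport along `e`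
  have heH : ∀ (g : κ.kerSubgroup) (m : M₁), e (g • m) = g • e m := fun g m ↦
    he (g : absoluteGaloisGroup K) m
  have heG : ∀ (g : kerD κ 𝔭) (m : M₁), e (g • m) = g • e m := fun g m ↦
    he ((g : decomp (K := K) 𝔭) : absoluteGaloisGroup K) m
  let eH : Literature.NumberTheory.EllipticCurves.subgroupH1 κ.kerSubgroup M₁ ≃+
      Literature.NumberTheory.EllipticCurves.subgroupH1 κ.kerSubgroup M₂ := h1Equiv e heH
  let eG : Literature.NumberTheory.EllipticCurves.subgroupH1 (kerD κ 𝔭) M₁ ≃+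
      Literature.NumberTheory.EllipticCurves.subgroupH1 (kerD κ 𝔭) M₂ := h1Equiv e heG
  have heH_apply : ∀ y, eH y = resH1Hom (ContinuousMonoidHom.id κ.kerSubgroup) (e : M₁ →+ M₂) heH y :=
    fun y ↦ h1Equiv_apply e heH y
  have heG_apply : ∀ y, eG y = resH1Hom (ContinuousMonoidHom.id (kerD κ 𝔭)) (e : M₁ →+ M₂) heG y :=
    fun y ↦ h1Equiv_apply e heG y
  -- naturality with `res_G` and with conjugation
  have hres : ∀ y, eG (resKerD κ M₁ 𝔭 y) = resKerD κ M₂ 𝔭 (eH y) := by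
    intro y
    rw [heG_apply, heH_apply]
    change ((resH1Hom (ContinuousMonoidHom.id (kerD κ 𝔭)) (e : M₁ →+ M₂) heG).comp (resKerD κ M₁ 𝔭)) y =
      ((resKerD κ M₂ 𝔭).comp (resH1Hom (ContinuousMonoidHom.id κ.kerSubgroup) (e : M₁ →+ M₂) heH)) y
    rw [resKerD, resKerD, resH1Hom_comp, resH1Hom_comp]
    exact congrFun (congrArg DFunLike.coe (resH1Hom_congr (by ext; rfl) (by ext; rfl) _ _)) y
  have hconj : ∀ (σ : absoluteGaloisGroup K) y,
      eH (Literature.NumberTheory.EllipticCurves.conjH1 κ.kerSubgroup M₁ σ y) =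
        Literature.NumberTheory.EllipticCurves.conjH1 κ.kerSubgroup M₂ σ (eH y) := by
    intro σ y
    rw [heH_apply, heH_apply]
    exact (congrArg (fun f : Literature.NumberTheory.EllipticCurves.subgroupH1 κ.kerSubgroup M₁ →+ _ ↦ f y)
      (FineSelmerCoefficientMap.conjH1_comp_resH1Hom_id κ.kerSubgroup (e : M₁ →+ M₂) heH he σ)).symm
  -- `eH(U₁) ⊆ U₂` and `eH⁻¹(U₂) ⊆ U₁`
  have hU : ∀ y ∈ U₁, eH y ∈ U₂ := by
    intro y hy
    rw [mem_unramifiedOutside_iff] at hy ⊢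
    intro v hvS hpv σ
    rw [← hconj, heH_apply]
    exact resH1Hom_id_mem_unramifiedKer κ.kerSubgroup v (e : M₁ →+ M₂) he heH (hy v hvS hpv σ)
  have hes : ∀ (g : absoluteGaloisGroup K) (m : M₂), e.symm (g • m) = g • e.symm m := fun g m ↦ by
    apply e.injective; rw [e.apply_symm_apply, he, e.apply_symm_apply]
  have hesH : ∀ (g : κ.kerSubgroup) (m : M₂), e.symm (g • m) = g • e.symm m := fun g m ↦
    hes (g : absoluteGaloisGroup K) m
  have heH_symm : ∀ y, eH.symm y = resH1Hom (ContinuousMonoidHom.id κ.kerSubgroup) (e.symm : M₂ →+ M₁) hesH y :=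
    fun _ ↦ rfl
  have hU' : ∀ y ∈ U₂, eH.symm y ∈ U₁ := by
    intro y hy
    rw [mem_unramifiedOutside_iff] at hy ⊢
    intro v hvS hpv σ
    have hc' : Literature.NumberTheory.EllipticCurves.conjH1 κ.kerSubgroup M₁ σ (eH.symm y) =
        eH.symm (Literature.NumberTheory.EllipticCurves.conjH1 κ.kerSubgroup M₂ σ y) := by
      apply eH.injective
      rw [hconj, eH.apply_symm_apply, eH.apply_symm_apply]
    rw [hc', heH_symm]
    exact resH1Hom_id_mem_unramifiedKer κ.kerSubgroup v (e.symm : M₂ →+ M₁) hes hesH (hy v hvS hpv σ)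
  -- the transport of `P` and of `Ψ`
  let eP : (Fin (p ^ c) → Literature.NumberTheory.EllipticCurves.subgroupH1 (kerD κ 𝔭) M₁) ≃+
      (Fin (p ^ c) → Literature.NumberTheory.EllipticCurves.subgroupH1 (kerD κ 𝔭) M₂) :=
    AddEquiv.piCongrRight fun _ ↦ eG
  have heP : ∀ f k, eP f k = eG (f k) := fun _ _ ↦ rfl
  have hΨe : ∀ u : U₁, eP (Ψ₁ u) = Ψ₂ ⟨eH u, hU u u.2⟩ := by
    intro u
    funext k
    rw [heP, hΨ₁, hΨ₂, hres, hconj]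
  have hmap : (Ψ₁.range).map (eP : _ →+ _) = Ψ₂.range := by
    ext f
    rw [AddSubgroup.mem_map, AddMonoidHom.mem_range]
    constructor
    · rintro ⟨g, ⟨u, rfl⟩, rfl⟩
      exact ⟨⟨eH u, hU u u.2⟩, by rw [← hΨe]; rfl⟩
    · rintro ⟨u, rfl⟩
      refine ⟨Ψ₁ ⟨eH.symm u, hU' u u.2⟩, ⟨_, rfl⟩, ?_⟩
      change eP (Ψ₁ ⟨eH.symm u, hU' u u.2⟩) = Ψ₂ u
      rw [hΨe]
      congr 1
      exact Subtype.ext (eH.apply_symm_apply u)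
  have hQ : Nat.card ((Fin (p ^ c) → Literature.NumberTheory.EllipticCurves.subgroupH1 (kerD κ 𝔭) M₁) ⧸ Ψ₁.range) =
      Nat.card ((Fin (p ^ c) → Literature.NumberTheory.EllipticCurves.subgroupH1 (kerD κ 𝔭) M₂) ⧸ Ψ₂.range) :=
    Nat.card_congr (QuotientAddGroup.congr Ψ₁.range Ψ₂.range eP hmap).toEquiv
  -- (6) count
  have hA₁ := natCard_comap_eq_natCard_ker_mul Ψ₁ T₁
  have hB₁ := natCard_eq_natCard_quotient_mul_of_sup Ψ₁ T₁ hsup₁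
  have hA₂ := natCard_comap_eq_natCard_ker_mul Ψ₂ T₂
  have hB₂ := natCard_eq_natCard_quotient_mul_of_sup Ψ₂ T₂ hsup₂
  have hQpos : Nat.card ((Fin (p ^ c) → Literature.NumberTheory.EllipticCurves.subgroupH1 (kerD κ 𝔭) M₁) ⧸
      Ψ₁.range) ≠ 0 := by
    intro h0
    rw [h0, zero_mul] at hB₁
    exact hTpos hB₁
  have e₁ : Nat.card (T₁.comap Ψ₁) *
      Nat.card ((Fin (p ^ c) → Literature.NumberTheory.EllipticCurves.subgroupH1 (kerD κ 𝔭) M₁) ⧸ Ψ₁.range) =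
        Nat.card Ψ₁.ker * Nat.card T₁ := by
    rw [hA₁, hB₁]; ring
  have e₂ : Nat.card (T₂.comap Ψ₂) *
      Nat.card ((Fin (p ^ c) → Literature.NumberTheory.EllipticCurves.subgroupH1 (kerD κ 𝔭) M₂) ⧸ Ψ₂.range) =
        Nat.card Ψ₂.ker * Nat.card T₂ := by
    rw [hA₂, hB₂]; ring
  rw [← hcomap₁, ← hcomap₂]
  apply Nat.eq_of_mul_eq_mul_right (Nat.pos_of_ne_zero hQpos)
  rw [e₁, hker, hTeq, ← e₂, hQ]

end Summit.BirchSwinnertonDyer.BirchSwinnertonDyer.Theorems.UniversalToricDescentStrictPlaceTuple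

end
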